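import Summits.QuantumFields.YangMills.Theorems.BalabanLadderNTCumulantPolarisationDefs
import Summits.QuantumFields.YangMills.Theorems.LangevinControlUVOSLegsFromFemtoAndGapStubCollar6
import Summits.QuantumFields.YangMills.Theses.UniversalDetector
import HarnessLib

/-!
# Route `UniversalDetector`, LINE g10-1 «Hankel tightness» — the (EDGE) clause of `SchemeEdgeLaws` is the two-site case of `E0′`

Ideator seat ym-idea-8 (generation 10, lens «dual»); support for the crux item `UniversalDetector.SchemeEdgeLaws`
(stmt-QuantumFields-23999).  Its first conjunct (EDGE) asks, in a unit `a → 0`, for a ceiling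
`|a⁻⁸ Cov_T(P_q(0), P_q(m e_k))| ≤ C(η)` of the DIAGONAL single-plane species along each axis at the lags of ONE femto
annulus `η ≤ a·m ≤ 2η` (`η ≤ η₀`).  This file proves that (EDGE) follows, for EVERY compact `G`, representation `r` and
unit `a → 0`, from the spine's plane-resolved collar output `MomentBounds6 G r a` (crux `OSLegsFromFemtoAndGap` /
`UVSeamRec` currency `E0′`) — its `n = 2` case read at the two sites `0` and `m e_k` with `R = ⌊(m-4)/2⌋`, giving
`C(η) = C² 4⁸ / η⁸` and `η₀ = ℓ₄`.  So (EDGE) is «spine currency» at whatever unit carries `E0′`; the crux still needs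
(TRANS) and (NONCONTACT) at the SAME unit, which nothing here supplies.

HONEST FRAMING: bookkeeping on an OPEN hypothesis (used as such); no ceiling is proved unconditionally; no summit is
proved by this line; not Clay.  Refs: Balaban, *Large field renormalization II*, Comm. Math. Phys. 122 (1989) (the
expected source of `E0′`); Glimm–Jaffe, *Quantum Physics* (1987) §19 (moment bounds as tightness input) [folklore].
-/

set_option autoImplicit false

noncomputable section

open MeasureTheory Filter Topology
open Literature.MathematicalPhysics.QuantumFieldTheory Literature.MathematicalPhysics.QuantumLattice
open Summit.QuantumFields.YangMills.Cruxes.OSLegsFromFemtoAndGap.DlrCollarTransfer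
open Summit.QuantumFields.YangMills.Cruxes.NT.CumulantPolarisation (torusE_centred_centred)

namespace Summit.QuantumFields.YangMills.Cruxes.UniversalDetectorHankel

variable {G : Type} [Group G] [TopologicalSpace G] [IsTopologicalGroup G] [CompactSpace G]
  [MeasurableSpace G] [BorelSpace G] (r : LatticeRep G)

/-- The two-site case of `MomentBounds6`: the centred product moment over `Fin 2` is the covariance, and two sites
`0`, `m e_k` with `2R+4 ≤ m ≤ L` are `2R+4`-separated on the odd torus `2L+1` along the coordinate `k`. [folklore] -/
theorem abs_cov_plane_axis_le_of_pair (β : ℝ) (L : ℕ) {C : ℝ} {R : ℕ} (q : Fin 4 × Fin 4) (hq : q.1 < q.2)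
    (k : Fin 4) (m : ℕ) (hRm : 2 * R + 4 ≤ m) (hmL : m ≤ L)
    (H : ∀ (n : ℕ) (qs : Fin n → Fin 4 × Fin 4) (x : Fin n → (Fin 4 → ℤ)), (∀ i, (qs i).1 < (qs i).2) →
      (∀ i j : Fin n, i ≠ j → ∃ k : Fin 4,
        (2 * (R : ℤ) + 4) ≤ |((((x i k - x j k : ℤ) : ZMod (2 * L + 1))).valMinAbs : ℤ)|) →
      |torusE G r β L (fun U => ∏ i, (plane G r (qs i) (x i) U - torusE G r β L (plane G r (qs i) (x i))))| ≤
        (C / (R : ℝ) ^ 4) ^ n) :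
    |torusE G r β L (fun U => plane G r q 0 U * plane G r q (Pi.single k (m : ℤ)) U) -
        torusE G r β L (plane G r q 0) * torusE G r β L (plane G r q (Pi.single k (m : ℤ)))| ≤
      (C / (R : ℝ) ^ 4) ^ 2 := by
  have hval : (((m : ℤ) : ZMod (2 * L + 1))).valMinAbs = (m : ℤ) := by
    have h1 : ((m : ℤ) : ZMod (2 * L + 1)) = ((m : ℕ) : ZMod (2 * L + 1)) := by push_cast; rfl
    rw [h1, ZMod.valMinAbs_natCast_of_le_half]
    omega
  have hsep : ∀ i j : Fin 2, i ≠ j → ∃ k' : Fin 4, (2 * (R : ℤ) + 4) ≤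
      |((((![(0 : Fin 4 → ℤ), Pi.single k (m : ℤ)] i k' - ![(0 : Fin 4 → ℤ), Pi.single k (m : ℤ)] j k' : ℤ) :
        ZMod (2 * L + 1))).valMinAbs : ℤ)| := by
    intro i j hij
    fin_cases i <;> fin_cases j
    · exact absurd rfl hij
    · refine ⟨k, ?_⟩
      have e : ((((0 : Fin 4 → ℤ) k - (Pi.single k (m : ℤ) : Fin 4 → ℤ) k : ℤ) : ZMod (2 * L + 1))) =
          -(((m : ℤ) : ZMod (2 * L + 1))) := by
        simp
      have h2 : (2 * (R : ℤ) + 4) ≤ |((-(((m : ℤ) : ZMod (2 * L + 1)))).valMinAbs : ℤ)| := by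
        rw [Int.abs_eq_natAbs, ZMod.natAbs_valMinAbs_neg, ← Int.abs_eq_natAbs, hval]
        rw [abs_of_nonneg (by positivity)]
        exact_mod_cast hRm
      simpa [e] using h2
    · refine ⟨k, ?_⟩
      have e : (((((Pi.single k (m : ℤ) : Fin 4 → ℤ) k - (0 : Fin 4 → ℤ) k) : ℤ) : ZMod (2 * L + 1))) =
          (((m : ℤ) : ZMod (2 * L + 1))) := by
        simp
      have h2 : (2 * (R : ℤ) + 4) ≤ |((((m : ℤ) : ZMod (2 * L + 1))).valMinAbs : ℤ)| := by
        rw [hval, abs_of_nonneg (by positivity)]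
        exact_mod_cast hRm
      simpa [e] using h2
    · exact absurd rfl hij
  have h := H 2 ![q, q] ![0, Pi.single k (m : ℤ)] (fun i => by fin_cases i <;> simpa using hq) hsep
  have hprod : (fun U => ∏ i : Fin 2, (plane G r (![q, q] i) (![(0 : Fin 4 → ℤ), Pi.single k (m : ℤ)] i) U -
      torusE G r β L (plane G r (![q, q] i) (![(0 : Fin 4 → ℤ), Pi.single k (m : ℤ)] i)))) =
      fun U => (plane G r q 0 U - torusE G r β L (plane G r q 0)) *
        (plane G r q (Pi.single k (m : ℤ)) U - torusE G r β L (plane G r q (Pi.single k (m : ℤ)))) := by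
    funext U
    rw [Fin.prod_univ_two]
    simp
  rw [hprod, torusE_centred_centred G r β L (continuous_plane r _ _) (continuous_plane r _ _)] at h
  have e : torusE G r β L (fun U => plane G r q 0 U * plane G r q (Pi.single k (m : ℤ)) U) -
        torusE G r β L (plane G r q (Pi.single k (m : ℤ))) * torusE G r β L (plane G r q 0) -
        torusE G r β L (plane G r q 0) * torusE G r β L (plane G r q (Pi.single k (m : ℤ))) +
        torusE G r β L (plane G r q 0) * torusE G r β L (plane G r q (Pi.single k (m : ℤ))) =
      torusE G r β L (fun U => plane G r q 0 U * plane G r q (Pi.single k (m : ℤ)) U) -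
        torusE G r β L (plane G r q 0) * torusE G r β L (plane G r q (Pi.single k (m : ℤ))) := by ring
  rwa [e] at h

/-- **`E0′` ⇒ (EDGE).**  For every compact `G`, representation `r` and unit `a → 0⁺`: the plane-resolved collar output
`MomentBounds6 G r a` implies the (EDGE) clause of `UniversalDetector.SchemeEdgeLaws` for `(r, a)` — the diagonal plane
kernels along each axis are bounded by `C² 4⁸ / η⁸` at the lags of the femto annulus `η ≤ a·m ≤ 2η`, for every
`η ≤ η₀ := ℓ₄`, `β ≥ β₅(η)`, `a L ≥ 5η`. [folklore bookkeeping on an open hypothesis] -/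
theorem edge_of_momentBounds6 (a : ℝ → ℝ) (ha : ∀ β, 0 < a β) (hlim : Tendsto a atTop (𝓝 0))
    (h : MomentBounds6 G r a) :
    ∃ η₀ : ℝ, 0 < η₀ ∧ ∀ η : ℝ, 0 < η → η ≤ η₀ → ∃ (C β₅ Λ₅ : ℝ), ∀ β : ℝ, β₅ ≤ β → ∀ L : ℕ, Λ₅ ≤ a β * L →
      ∀ q : Fin 4 × Fin 4, q.1 < q.2 → ∀ (k : Fin 4) (m : ℕ), η ≤ a β * m → a β * m ≤ 2 * η →
        |(a β)⁻¹ ^ 8 * (torusE G r β L (fun U => plane G r q 0 U * plane G r q (Pi.single k (m : ℤ)) U) -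
            torusE G r β L (plane G r q 0) * torusE G r β L (plane G r q (Pi.single k (m : ℤ))))| ≤ C := by
  obtain ⟨C, β₄, ℓ₄, hℓ₄, hC0, H⟩ := h
  refine ⟨ℓ₄, hℓ₄, fun η hη hηℓ => ?_⟩
  obtain ⟨B, hB⟩ := Filter.eventually_atTop.1 ((tendsto_order.1 hlim).2 (η / 10) (by positivity))
  refine ⟨C ^ 2 * 4 ^ 8 / η ^ 8, max β₄ B, 5 * η, fun β hβ L hL q hq k m hm1 hm2 => ?_⟩
  have hβ4 : β₄ ≤ β := le_trans (le_max_left _ _) hβ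
  have haη : a β < η / 10 := hB β (le_trans (le_max_right _ _) hβ)
  have ha0 : 0 < a β := ha β
  -- the lag is long in lattice units: `m ≥ 11`
  have hm10 : 10 < m := by
    by_contra hcon
    push Not at hcon
    have h1 : a β * m ≤ a β * 10 := by
      have : (m : ℝ) ≤ 10 := by exact_mod_cast hcon
      nlinarith
    nlinarith
  -- the collar radius
  set R : ℕ := (m - 4) / 2 with hRdef
  have hR1 : 1 ≤ R := by omega
  have hRm : 2 * R + 4 ≤ m := by omega
  have hmR : m ≤ 2 * R + 5 := by omega
  have hRreal : (2 * R : ℝ) ≤ m := by exact_mod_cast (by omega : 2 * R ≤ m)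
  have hRa : (R : ℝ) * a β ≤ ℓ₄ := by nlinarith
  have h2m : 2 * m ≤ L := by
    have h1 : a β * (2 * m : ℕ) ≤ a β * L := by
      push_cast
      nlinarith
    exact_mod_cast le_of_mul_le_mul_left h1 ha0
  have hL4 : 4 * R + 8 ≤ L := by omega
  have hmL : m ≤ L := by omega
  -- the two-site case of `MomentBounds6`
  have hcov := abs_cov_plane_axis_le_of_pair r β L q hq k m hRm hmL
    (fun n qs x hqs hsep => H β hβ4 L n qs x R hqs hR1 hRa hL4 hsep)
  -- `a⁻⁸ (C/R⁴)² ≤ C² 4⁸ / η⁸` because `η ≤ 4 a R`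
  have hR0 : (0 : ℝ) < R := by exact_mod_cast hR1
  have h4aR : η ≤ 4 * a β * R := by
    have h1 : (m : ℝ) ≤ 2 * R + 5 := by exact_mod_cast hmR
    nlinarith
  have hpow : η ^ 8 ≤ (4 * a β * R) ^ 8 := pow_le_pow_left₀ hη.le h4aR 8
  rw [abs_mul, abs_of_nonneg (by positivity)]
  calc (a β)⁻¹ ^ 8 * |torusE G r β L (fun U => plane G r q 0 U * plane G r q (Pi.single k (m : ℤ)) U) -
          torusE G r β L (plane G r q 0) * torusE G r β L (plane G r q (Pi.single k (m : ℤ)))|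
      ≤ (a β)⁻¹ ^ 8 * (C / (R : ℝ) ^ 4) ^ 2 := by gcongr
    _ = C ^ 2 * 4 ^ 8 / (4 * a β * R) ^ 8 := by
        field_simp
    _ ≤ C ^ 2 * 4 ^ 8 / η ^ 8 := by
        apply div_le_div_of_nonneg_left (by positivity) (by positivity) hpow

end Summit.QuantumFields.YangMills.Cruxes.UniversalDetectorHankel

end
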